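import Summits.AtomisticToContinuum.Crystallization.Theorems.FrustratedLawDichotomyMinimiserNecessaryConditions
import Summits.AtomisticToContinuum.Crystallization.Theorems.FrustratedLawDichotomyBindingFloor

/-!
# FrustratedLawDichotomy · crux `AperiodicFrustratedLawGap` (stmt-AtomisticToContinuum-27623) — NECESSARY CONDITIONS ON PALM MINIMISERS:
# omnibus of record after generation 4 (hand 2)

`minimiser_necessary_conditions_g4`: ONE `obtain`-able statement = the generation-2 omnibus `minimiser_necessary_conditions` (mean `= e⋆`,
virial, `E[rootEnergy] = −E I₁₂/24`, `GL₃`-stability, zero Palm stress, Born stability, a.s. infinite, compressed root w.p.p., no rattlers)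
PLUS the two ONE-ATOM FLOORS of generation 4 (Sütő's deletion / insertion tests of an `e⋆`-μGSC, law level made pointwise):

* (10) BINDING FLOOR at every atom: a.s. `∀ y ∈ μ, 2·rootEnergy(θ_y μ) ≤ e⋆ + ½ ∫ V_LJ⁺(‖z‖) d(θ_y μ)`
  (`FrustratedLawDichotomyBindingFloor.ae_forall_bindingFloor_of_minimising`);
* (11) VACANCY FLOOR at the root, every site: `∀ u, ∀ s > 0`, a.s. `μ(B(u,s)) = 0 → e⋆ ≤ ∫ V_LJ(‖z − u‖) dμ + ½ ∫ V_LJ⁺(‖z‖) dμ`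
  (`FrustratedLawDichotomyThickening.vacancyFloor_of_minimising`);
* (12) VACANCY FLOOR at every atom, all rational sites at once (`ae_forall_vacancyFloor_of_minimising`).

Short vocabulary (`E3`, `eStar`), no route decl; the by-name cuts are `…AperiodicGapInsertionCut`, `…AperiodicGapOneAtomFloorCut`,
`…PeriodicGapOneAtomFloorCut`.  All `[folklore]`.
-/

noncomputable section

namespace Summit.AtomisticToContinuum.Crystallization.Theorems.FrustratedLawDichotomyBindingFloor

open MeasureTheory Metric Set
open scoped RealInnerProductSpace
open Literature.MathematicalPhysics.StatisticalMechanics Literature.Probability.Process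
open Summit.AtomisticToContinuum.Crystallization.Theorems.ChargedEnergyGapNegative (E3 eStar)
open Summit.AtomisticToContinuum.Crystallization.Theorems.FrustratedLawDichotomyVirial (minimiser_necessary_conditions)
open Summit.AtomisticToContinuum.Crystallization.Theorems.FrustratedLawDichotomyThickening
  (vacancyFloor_of_minimising ae_forall_vacancyFloor_of_minimising)

/-- **NECESSARY CONDITIONS ON PALM MINIMISERS — omnibus of record after generation 4.**  Granted the energy floor for point-stationary hard-core
probability laws (item 9229, hypothesis `hU`), a point-stationary `δ`-hard-core probability law `P` with `E_P[rootEnergy] ≤ e⋆` satisfies the nine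
conditions of `minimiser_necessary_conditions` and moreover: (10) the BINDING FLOOR at every atom, (11) the VACANCY FLOOR at every site (seen from
the root), (12) the vacancy floor at every atom for all rational sites simultaneously. [folklore] -/
theorem minimiser_necessary_conditions_g4
    (hU : ∀ δ' : ℝ, 0 < δ' → ∀ Q : Measure (Measure E3), IsProbabilityMeasure Q → (∀ᵐ μ ∂Q, IsRootedHardCore δ' μ) →
      IsPointStationaryLaw Q → eStar ≤ ∫ μ, rootEnergy lennardJones μ ∂Q)
    {δ : ℝ} (hδ : 0 < δ) {P : Measure (Measure E3)} [IsProbabilityMeasure P] (hcore : ∀ᵐ μ ∂P, IsRootedHardCore δ μ)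
    (hstat : IsPointStationaryLaw P) (hmin : ∫ μ, rootEnergy lennardJones μ ∂P ≤ eStar) :
    ((∫ μ, rootEnergy lennardJones μ ∂P = eStar) ∧
    (∫ μ, ∫ y, ‖y‖⁻¹ ^ 6 ∂μ ∂P = ∫ μ, ∫ y, ‖y‖⁻¹ ^ 12 ∂μ ∂P) ∧
    (∫ μ, rootEnergy lennardJones μ ∂P = -(1 / 24) * ∫ μ, ∫ y, ‖y‖⁻¹ ^ 12 ∂μ ∂P) ∧
    (∀ A : E3 ≃L[ℝ] E3, ∫ μ, rootEnergy lennardJones μ ∂P ≤ ∫ μ, (∫ y, lennardJones ‖A y‖ ∂μ) / 2 ∂P) ∧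
    (∀ H : E3 →L[ℝ] E3, ∫ μ, ∫ s, (‖s‖⁻¹ ^ 8 - ‖s‖⁻¹ ^ 14) * ⟪s, H s⟫ ∂μ ∂P = 0) ∧
    (∀ H : E3 →L[ℝ] E3,
      0 ≤ ∫ μ, ∫ s, (14 * ‖s‖⁻¹ ^ 16 - 8 * ‖s‖⁻¹ ^ 10) * ⟪s, H s⟫ ^ 2 + (‖s‖⁻¹ ^ 8 - ‖s‖⁻¹ ^ 14) * ‖H s‖ ^ 2 ∂μ ∂P) ∧
    (∀ᵐ μ ∂P, {p : E3 | μ {p} ≠ 0}.Infinite) ∧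
    (¬ ∀ᵐ μ ∂P, ∀ s : E3, μ {s} ≠ 0 → s ≠ 0 → 1 ≤ ‖s‖) ∧
    (∀ R : ℝ, δ ≤ R → 10 < δ * R → ∀ᵐ μ ∂P, ∀ y : E3, μ {y} ≠ 0 → 1 < μ (closedBall y R))) ∧
    -- (10) binding floor at every atom
    (∀ᵐ μ ∂P, ∀ y : E3, μ {y} ≠ 0 →
      2 * rootEnergy lennardJones (μ.map fun z : E3 => z - y) ≤ eStar + (∫ z, max (lennardJones ‖z‖) 0 ∂(μ.map fun z : E3 => z - y)) / 2) ∧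
    -- (11) vacancy floor at every site, seen from the root
    (∀ u : E3, ∀ s : ℝ, 0 < s → ∀ᵐ μ ∂P, μ (ball u s) = 0 →
      eStar ≤ (∫ z, lennardJones ‖z - u‖ ∂μ) + (∫ z, max (lennardJones ‖z‖) 0 ∂μ) / 2) ∧
    -- (12) vacancy floor at every atom, all rational sites at once
    (∀ᵐ μ ∂P, ∀ y : E3, μ {y} ≠ 0 → ∀ v : Fin 3 → ℚ, ∀ r : ℚ, 0 < (r : ℝ) →
      (μ.map fun z : E3 => z - y) (ball ((EuclideanSpace.equiv (Fin 3) ℝ).symm fun c => (v c : ℝ)) r) = 0 →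
        eStar ≤ (∫ z, lennardJones ‖z - (EuclideanSpace.equiv (Fin 3) ℝ).symm (fun c => (v c : ℝ))‖ ∂(μ.map fun z : E3 => z - y)) +
          (∫ z, max (lennardJones ‖z‖) 0 ∂(μ.map fun z : E3 => z - y)) / 2) :=
  ⟨minimiser_necessary_conditions hU hδ hcore hstat hmin, ae_forall_bindingFloor_of_minimising hU hδ hcore hstat hmin,
    fun u _ hs => vacancyFloor_of_minimising hU hδ hcore hstat hmin u hs, ae_forall_vacancyFloor_of_minimising hU hδ hcore hstat hmin⟩

end Summit.AtomisticToContinuum.Crystallization.Theorems.FrustratedLawDichotomyBindingFloor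

end
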